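import Summits.AtomisticToContinuum.HydrodynamicLimit.Theorems.LambertianContactSwapLambertianEulerCollisionIntensity
import Summits.AtomisticToContinuum.HydrodynamicLimit.Theorems.LambertianContactSwapLambertianEulerAprioriEntropyBound
import HarnessLib

/-!
# The collision budget `(K_b + 1)(1 + E)` is integrable under local Gibbs data
# (`LambertianContactSwap.LambertianEuler`, stmt-AtomisticToContinuum-11854, line `Sketch`; stub `stub_collisionBudgetIntegrableLambda`)

Worker file (`--supports stmt-AtomisticToContinuum-11854`) closing the registered stub
`stub_collisionBudgetIntegrableLambda` of the lead's skeleton of line `Sketch`: the integrability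
hypothesis of the landed collision COMPENSATOR of the Lambertian hard-sphere gas `Λ` on `𝕋³`
(`…LambertianEulerCollisionCompensator.stub_collisionCompensatorLambda`), discharged at FIXED `N` under
local Gibbs data.

**Statement.** Assume the shell collision-intensity bound (the landed
`…LambertianEulerCollisionIntensity.stub_collisionIntensityLambda`): for `0 < ε < 1/2` and `N` spheres
there are `C < ∞` and `k` with `∫⁻_{(D ∩ {E ≤ V²/2}) × (ℕ → V3)} K_t d(vol ⊗ γ^ℕ) ≤ C (1 + V)^k t`
(`K_t = lambertCount`, the number of Lambertian collisions in `[0, t]`, `γ^ℕ = lambertNoise (Fin 3)`).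
Then for `0 < σ < 1/2`, continuous data profiles `a₀, θ₀ > 0`, `u₀`, every `N`, flow `Φ` and `b ≥ 0`,
`q ↦ (K_b(q) + 1)(1 + E(q.1))` is integrable under `λ_N ⊗ γ^ℕ`, `λ_N = localGibbsLaw σ a₀ u₀ θ₀ N Φ`.

**Proof.** `λ_N ⊗ γ^ℕ = (vol|_D ⊗ γ^ℕ) · ρ_λ(z)` (`localGibbsLaw_eq_withDensity_liouville`,
`prod_withDensity_left`), and the canonical density of a local Gibbs profile is dominated by a
GAUSSIAN in the velocities: on the hard-sphere domain
`log ρ_λ(z) = −log Z + Σᵢ [log a₀(xᵢ) − (3/2) log(2πθ₀(xᵢ)) − |vᵢ − u₀(xᵢ)|²/(2θ₀(xᵢ))]`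
(`log_canonicalDensity_localGibbsProfile_eq`), and with `θ₀ ≤ Mθ`, `|u₀| ≤ Mu` (compactness of `𝕋³`),
`|v − u|² ≥ |v|²/2 − Mu²`, one gets `ρ_λ(z) ≤ A exp(−β E(z))`, `β = 1/(2Mθ)`
(`collisionBudget_canonicalDensity_le`). Decompose the domain into the energy shells
`n²/2 ≤ E < (n+1)²/2`, `n ∈ ℕ`: on the `n`-th shell `ρ_λ (1 + E) ≤ A e^{−βn²/2} (1 + (n+1)²/2)`, so the
integrand is dominated by the series `Σₙ c_n 𝟙_{S_n × univ} (K_b + 1)`, `S_n = D ∩ {E ≤ (n+1)²/2}`;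
by Tonelli for series (`lintegral_tsum`), the shell intensity bound (`∫ K_b ≤ C (n+2)^k b`) and the
shell volume `vol(S_n) ≤ vol(B̄_{n+1})^N = ((n+1)³ vol B₁)^N` (`volume_velBall`), the integral is at most
`Σₙ A e^{−βn²/2} (1 + (n+1)²/2) (C (n+2)^k b + ((n+1)³ vol B₁)^N) ≤ A' Σₙ (n+2)^{k+3N+2} e^{−βn/2} < ∞`
(`Real.summable_pow_mul_exp_neg_nat_mul`). Integrability is this finiteness plus the joint
measurability of `K_b` (`measurable_lambertCount`) and of `E` (`measurable_configEnergy`).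

References: I. Gallagher, L. Saint-Raymond, B. Texier, *From Newton to Boltzmann* (EMS 2013), §4.1
and §6.1 (Gaussian domination of Gibbs-type data); H. Spohn, *Large Scale Dynamics of Interacting
Particles* (1991), Part I §2.3. Lead c4 wave 1, stub worker.
-/

noncomputable section

open scoped BigOperators Topology ENNReal InnerProductSpace
open MeasureTheory ProbabilityTheory Filter Set InformationTheory
open Literature.MathematicalPhysics.KineticTheory
open Literature.Analysis.FluidPDE Literature.Analysis.FluidPDE.Alexander

namespace Summit.AtomisticToContinuum.HydrodynamicLimit.Theorems.LambertianContactSwapLambertianEulerCollisionBudget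

/-! ## Elementary bounds -/

/-- The kinetic energy `E(z) = ½ Σᵢ |vᵢ|²` is nonnegative. [folklore] -/
theorem collisionBudget_configEnergy_nonneg {n : ℕ} (z : Config n (Fin 3) T3) : 0 ≤ configEnergy z := by
  unfold configEnergy
  exact mul_nonneg (by norm_num) (Finset.sum_nonneg fun i _ => sq_nonneg _)

/-- Every energy `E ≥ 0` lies in one of the shells `n²/2 ≤ E ≤ (n+1)²/2`, `n ∈ ℕ`
(`n = ⌊√(2E)⌋`). [folklore] -/
theorem collisionBudget_exists_shell {E : ℝ} (hE : 0 ≤ E) :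
    ∃ n : ℕ, (n : ℝ) ^ 2 / 2 ≤ E ∧ E ≤ ((n : ℝ) + 1) ^ 2 / 2 := by
  refine ⟨⌊Real.sqrt (2 * E)⌋₊, ?_, ?_⟩
  · have h1 : (⌊Real.sqrt (2 * E)⌋₊ : ℝ) ≤ Real.sqrt (2 * E) := Nat.floor_le (Real.sqrt_nonneg _)
    have h2 : (⌊Real.sqrt (2 * E)⌋₊ : ℝ) ^ 2 ≤ 2 * E :=
      calc (⌊Real.sqrt (2 * E)⌋₊ : ℝ) ^ 2 ≤ Real.sqrt (2 * E) ^ 2 :=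
            pow_le_pow_left₀ (Nat.cast_nonneg _) h1 2
        _ = 2 * E := Real.sq_sqrt (by linarith)
    linarith
  · have h1 : Real.sqrt (2 * E) < (⌊Real.sqrt (2 * E)⌋₊ : ℝ) + 1 := Nat.lt_floor_add_one _
    have h2 : 2 * E < ((⌊Real.sqrt (2 * E)⌋₊ : ℝ) + 1) ^ 2 := Real.lt_sq_of_sqrt_lt h1
    linarith

/-- **Summability of the Gaussian–polynomial series**: `Σₙ (n + 2)^K e^{−r n} < ∞` for `r > 0`
(shift of `Real.summable_pow_mul_exp_neg_nat_mul`). [folklore] -/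
theorem collisionBudget_summable_pow_mul_exp (K : ℕ) {r : ℝ} (hr : 0 < r) :
    Summable fun n : ℕ => ((n : ℝ) + 2) ^ K * Real.exp (-(r * n)) := by
  have h := ((summable_nat_add_iff 2).2 (Real.summable_pow_mul_exp_neg_nat_mul K hr)).mul_left
    (Real.exp (2 * r))
  refine h.congr fun n => ?_
  have he : Real.exp (2 * r) * Real.exp (-r * ((n : ℝ) + 2)) = Real.exp (-(r * n)) := by
    rw [← Real.exp_add]
    congr 1
    ring
  push_cast
  calc Real.exp (2 * r) * (((n : ℝ) + 2) ^ K * Real.exp (-r * ((n : ℝ) + 2)))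
      = ((n : ℝ) + 2) ^ K * (Real.exp (2 * r) * Real.exp (-r * ((n : ℝ) + 2))) := by ring
    _ = ((n : ℝ) + 2) ^ K * Real.exp (-(r * n)) := by rw [he]

/-- **The per-shell term of the collision budget is Gaussian–polynomial**: with `m = n + 2`,
`A e^{−βn²/2} (1 + (n+1)²/2) (C (n+2)^k b + ((n+1)³ B)^M) ≤ A (C b + B^M) m^{k+3M+2} e^{−βn/2}`
(`n ≤ n²`, `1 + (n+1)²/2 ≤ m²`, `(n+1)^{3M}, m^k ≤ m^{k+3M}`). [folklore] -/
theorem collisionBudget_term_le {A β C b B : ℝ} (hA : 0 ≤ A) (hβ : 0 < β) (hC : 0 ≤ C) (hb : 0 ≤ b)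
    (hB : 0 ≤ B) (k M n : ℕ) :
    A * Real.exp (-(β * ((n : ℝ) ^ 2 / 2))) * (1 + ((n : ℝ) + 1) ^ 2 / 2) *
        (C * (1 + ((n : ℝ) + 1)) ^ k * b + (((n : ℝ) + 1) ^ 3 * B) ^ M) ≤
      A * (C * b + B ^ M) * (((n : ℝ) + 2) ^ (k + 3 * M + 2) * Real.exp (-(β / 2 * n))) := by
  have hn0 : (0 : ℝ) ≤ n := n.cast_nonneg
  have hm1 : (1 : ℝ) ≤ (n : ℝ) + 2 := by linarith
  have hexp : Real.exp (-(β * ((n : ℝ) ^ 2 / 2))) ≤ Real.exp (-(β / 2 * n)) := by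
    rw [Real.exp_le_exp]
    have h : (n : ℝ) ≤ (n : ℝ) ^ 2 := by exact_mod_cast Nat.le_self_pow two_ne_zero n
    nlinarith [mul_le_mul_of_nonneg_left h hβ.le]
  have hsq : 1 + ((n : ℝ) + 1) ^ 2 / 2 ≤ ((n : ℝ) + 2) ^ 2 := by nlinarith [sq_nonneg (n : ℝ)]
  have h1 : (1 + ((n : ℝ) + 1)) ^ k ≤ ((n : ℝ) + 2) ^ (k + 3 * M) := by
    rw [show 1 + ((n : ℝ) + 1) = (n : ℝ) + 2 by ring]
    exact pow_le_pow_right₀ hm1 (Nat.le_add_right _ _)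
  have h2 : (((n : ℝ) + 1) ^ 3 * B) ^ M ≤ B ^ M * ((n : ℝ) + 2) ^ (k + 3 * M) := by
    rw [mul_pow, ← pow_mul, mul_comm]
    refine mul_le_mul_of_nonneg_left ?_ (pow_nonneg hB _)
    calc ((n : ℝ) + 1) ^ (3 * M) ≤ ((n : ℝ) + 2) ^ (3 * M) :=
          pow_le_pow_left₀ (by positivity) (by linarith) _
      _ ≤ ((n : ℝ) + 2) ^ (k + 3 * M) := pow_le_pow_right₀ hm1 (Nat.le_add_left _ _)
  have hpoly : C * (1 + ((n : ℝ) + 1)) ^ k * b + (((n : ℝ) + 1) ^ 3 * B) ^ M ≤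
      (C * b + B ^ M) * ((n : ℝ) + 2) ^ (k + 3 * M) :=
    calc C * (1 + ((n : ℝ) + 1)) ^ k * b + (((n : ℝ) + 1) ^ 3 * B) ^ M
        ≤ C * ((n : ℝ) + 2) ^ (k + 3 * M) * b + B ^ M * ((n : ℝ) + 2) ^ (k + 3 * M) :=
          add_le_add (mul_le_mul_of_nonneg_right (mul_le_mul_of_nonneg_left h1 hC) hb) h2
      _ = (C * b + B ^ M) * ((n : ℝ) + 2) ^ (k + 3 * M) := by ring
  calc A * Real.exp (-(β * ((n : ℝ) ^ 2 / 2))) * (1 + ((n : ℝ) + 1) ^ 2 / 2) *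
        (C * (1 + ((n : ℝ) + 1)) ^ k * b + (((n : ℝ) + 1) ^ 3 * B) ^ M)
      ≤ A * Real.exp (-(β / 2 * n)) * ((n : ℝ) + 2) ^ 2 *
          ((C * b + B ^ M) * ((n : ℝ) + 2) ^ (k + 3 * M)) := by gcongr
    _ = A * (C * b + B ^ M) * (((n : ℝ) + 2) ^ (k + 3 * M + 2) * Real.exp (-(β / 2 * n))) := by ring

/-! ## Gaussian domination of the local Gibbs density -/

/-- **Upper bound of the one-body exponent by a negative-definite quadratic form in `v`**: if
`|log a| ≤ Ka`, `|log 2πθ| ≤ Kθ`, `0 < θ ≤ Mθ` and `|u| ≤ Mu`, then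
`log a(x) − (3/2) log(2πθ(x)) − |v − u(x)|²/(2θ(x)) ≤ Ka + (3/2) Kθ + 2Mu²/(4Mθ) − |v|²/(4Mθ)`
(`|v − u|²/(2θ) ≥ |v − u|²/(2Mθ)` and `|v|² ≤ 2|v − u|² + 2Mu²`). [folklore] -/
theorem collisionBudget_oneBody_le {a θ : T3 → ℝ} {u : T3 → V3} {Ka Kθ Mθ Mu : ℝ}
    (hKa : ∀ x, |Real.log (a x)| ≤ Ka) (hKθ : ∀ x, |Real.log (2 * Real.pi * θ x)| ≤ Kθ)
    (hθ0 : ∀ x, 0 < θ x) (hθM : ∀ x, θ x ≤ Mθ) (huM : ∀ x, ‖u x‖ ≤ Mu) (x : T3) (v : V3) :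
    Real.log (a x) + (-(3 / 2) * Real.log (2 * Real.pi * θ x) - ‖v - u x‖ ^ 2 / (2 * θ x)) ≤
      Ka + 3 / 2 * Kθ + (4 * Mθ)⁻¹ * (2 * Mu ^ 2) - (4 * Mθ)⁻¹ * ‖v‖ ^ 2 := by
  have hM : 0 < Mθ := (hθ0 x).trans_le (hθM x)
  have hMu0 : 0 ≤ Mu := (norm_nonneg _).trans (huM x)
  have h1 : Real.log (a x) ≤ Ka := (le_abs_self _).trans (hKa x)
  have h2 : -Kθ ≤ Real.log (2 * Real.pi * θ x) := (abs_le.1 (hKθ x)).1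
  have h3 : ‖v - u x‖ ^ 2 / (2 * Mθ) ≤ ‖v - u x‖ ^ 2 / (2 * θ x) :=
    div_le_div_of_nonneg_left (sq_nonneg _) (mul_pos two_pos (hθ0 x)) (by linarith [hθM x])
  have h4 : ‖v‖ ^ 2 ≤ 2 * ‖v - u x‖ ^ 2 + 2 * Mu ^ 2 := by
    have hle : ‖v‖ ≤ ‖v - u x‖ + Mu := by linarith [norm_sub_norm_le v (u x), huM x]
    nlinarith [mul_nonneg (sub_nonneg.2 hle)
      (add_nonneg (add_nonneg (norm_nonneg (v - u x)) hMu0) (norm_nonneg v)),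
      sq_nonneg (‖v - u x‖ - Mu)]
  have h5 : ‖v - u x‖ ^ 2 / (2 * Mθ) = (4 * Mθ)⁻¹ * (2 * ‖v - u x‖ ^ 2) := by
    field_simp
    ring
  have hκ : 0 ≤ (4 * Mθ)⁻¹ := by positivity
  linarith [mul_le_mul_of_nonneg_left h4 hκ]

/-- **Gaussian domination of the canonical density of a local Gibbs profile**: for `σ ≤ 1/2` and
continuous profiles `a₀, θ₀ > 0`, `u₀` there are `A ≥ 0` and `β > 0` (depending on `N` and the
profiles) with `ρ_λ(z) ≤ A exp(−β E(z))` for EVERY configuration `z` of `N + 1` spheres (on the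
hard-sphere domain by `log_canonicalDensity_localGibbsProfile_eq` and `collisionBudget_oneBody_le`
with `β = 1/(2 max θ₀)`; off the domain the density vanishes). [folklore] -/
theorem collisionBudget_canonicalDensity_le {σ : ℝ} (hσ2 : σ ≤ 1 / 2) {a₀ θ₀ : T3 → ℝ} {u₀ : T3 → V3}
    (ha : Continuous a₀) (hθ : Continuous θ₀) (hu : Continuous u₀) (ha0 : ∀ x, 0 < a₀ x)
    (hθ0 : ∀ x, 0 < θ₀ x) (N : ℕ) :
    ∃ A β : ℝ, 0 ≤ A ∧ 0 < β ∧ ∀ z : Config (N + 1) (Fin 3) T3,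
      canonicalDensity (Torus.geometry (Fin 3)) (hsDiameter σ N) (N + 1) (localGibbsProfile a₀ u₀ θ₀) z ≤
        A * Real.exp (-(β * configEnergy z)) := by
  obtain ⟨Ka, -, hKa⟩ := exists_abs_log_le_of_continuous ha ha0
  obtain ⟨Kθ, -, hKθ⟩ := exists_abs_log_le_of_continuous (f := fun x => 2 * Real.pi * θ₀ x)
    (continuous_const.mul hθ) (fun x => mul_pos (mul_pos two_pos Real.pi_pos) (hθ0 x))
  obtain ⟨Mθ, hMθ⟩ := exists_le_of_continuous hθ
  obtain ⟨Mu, hMu⟩ := exists_le_of_continuous (f := fun x => ‖u₀ x‖) hu.norm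
  have hM : 0 < Mθ := (hθ0 0).trans_le (hMθ 0)
  refine ⟨Real.exp (-Real.log (posPartition a₀ (hsDiameter σ N) (N + 1)) +
      ((N : ℝ) + 1) * (Ka + 3 / 2 * Kθ + (4 * Mθ)⁻¹ * (2 * Mu ^ 2))), (2 * Mθ)⁻¹,
    (Real.exp_pos _).le, by positivity, fun z => ?_⟩
  by_cases hz : z ∈ hardSphereDomain (Torus.geometry (Fin 3)) (N + 1) (hsDiameter σ N)
  · have hpos := canonicalDensity_localGibbsProfile_pos (u := u₀) ha hθ hu ha0 hθ0 hσ2 N hz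
    rw [← Real.exp_log hpos, ← Real.exp_add, Real.exp_le_exp,
      log_canonicalDensity_localGibbsProfile_eq ha hθ hu ha0 hθ0 hσ2 N hz]
    have hsum : ∑ i, (Real.log (a₀ (z i).1) + (-(3 / 2) * Real.log (2 * Real.pi * θ₀ (z i).1) -
        ‖(z i).2 - u₀ (z i).1‖ ^ 2 / (2 * θ₀ (z i).1))) ≤
        ∑ _i : Fin (N + 1), (Ka + 3 / 2 * Kθ + (4 * Mθ)⁻¹ * (2 * Mu ^ 2)) -
          ∑ i, (4 * Mθ)⁻¹ * ‖(z i).2‖ ^ 2 := by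
      rw [← Finset.sum_sub_distrib]
      exact Finset.sum_le_sum fun i _ => collisionBudget_oneBody_le hKa hKθ hθ0 hMθ hMu _ _
    rw [Finset.sum_const, Finset.card_univ, Fintype.card_fin, nsmul_eq_mul, ← Finset.mul_sum] at hsum
    have hE : (2 * Mθ)⁻¹ * configEnergy z = (4 * Mθ)⁻¹ * ∑ i, ‖(z i).2‖ ^ 2 := by
      simp only [configEnergy]
      ring
    push_cast at hsum
    linarith
  · have h0 : canonicalDensity (Torus.geometry (Fin 3)) (hsDiameter σ N) (N + 1)
        (localGibbsProfile a₀ u₀ θ₀) z = 0 := by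
      simp [canonicalDensity, Set.indicator_of_notMem hz]
    rw [h0]
    positivity

/-! ## The shell decomposition -/

/-- **Finiteness of the Gaussian-weighted collision budget by energy shells.** Let `K ≥ 0` be a
jointly measurable count on `(datum, noise)` whose integral over every energy shell
`(D ∩ {E ≤ V²/2}) × univ` of `vol ⊗ γ^ℕ` is at most `C (1 + V)^k b` (`C < ∞`), and `0 ≤ ρ ≤ A e^{−βE}`
(`β > 0`). Then `∫⁻_{D × univ} ρ (K + 1)(1 + E) d(vol ⊗ γ^ℕ) < ∞`: dominate the integrand on the shell
`n²/2 ≤ E ≤ (n+1)²/2` by `A e^{−βn²/2} (1 + (n+1)²/2) 𝟙_{S_n × univ} (K + 1)`, `S_n = D ∩ {E ≤ (n+1)²/2}`,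
sum over `n` (`lintegral_tsum`), bound `∫_{S_n × univ} (K + 1) ≤ C (n+2)^k b + ((n+1)³ vol B₁)^N`
(`volume_velBall`, `Measure.addHaar_closedBall`) and sum the Gaussian–polynomial series
(`collisionBudget_term_le`, `collisionBudget_summable_pow_mul_exp`). [folklore] -/
theorem collisionBudget_lintegral_lt_top {N : ℕ} {D : Set (Config N (Fin 3) T3)} (hD : MeasurableSet D)
    {K : Config N (Fin 3) T3 × (ℕ → V3) → ℕ} (hK : Measurable K) {C : ℝ≥0∞} (hC : C < ∞) {k : ℕ}
    {b : ℝ} (hb : 0 ≤ b)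
    (hCk : ∀ V : ℝ, 0 ≤ V →
      ∫⁻ p in {z : Config N (Fin 3) T3 | z ∈ D ∧ configEnergy z ≤ V ^ 2 / 2} ×ˢ (Set.univ : Set (ℕ → V3)),
          (K p : ℝ≥0∞) ∂((volume : Measure (Config N (Fin 3) T3)).prod (lambertNoise (Fin 3))) ≤
        C * ENNReal.ofReal ((1 + V) ^ k) * ENNReal.ofReal b)
    {ρ : Config N (Fin 3) T3 → ℝ} (hρ0 : ∀ z, 0 ≤ ρ z) {A β : ℝ} (hA : 0 ≤ A) (hβ : 0 < β)
    (hρle : ∀ z, ρ z ≤ A * Real.exp (-(β * configEnergy z))) :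
    ∫⁻ q in D ×ˢ (Set.univ : Set (ℕ → V3)),
        ENNReal.ofReal (ρ q.1) * ENNReal.ofReal (((K q : ℝ) + 1) * (1 + configEnergy q.1))
      ∂((volume : Measure (Config N (Fin 3) T3)).prod (lambertNoise (Fin 3))) < ∞ := by
  haveI hXE : SigmaFinite (volume : Measure (T3 × V3)) := inferInstance
  haveI hCv : SigmaFinite (volume : Measure (Config N (Fin 3) T3)) := inferInstance
  -- real forms of the two finite constants `C` and `vol B₁`
  obtain ⟨C', hC'0, rfl⟩ : ∃ C' : ℝ, 0 ≤ C' ∧ C = ENNReal.ofReal C' :=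
    ⟨C.toReal, ENNReal.toReal_nonneg, (ENNReal.ofReal_toReal hC.ne).symm⟩
  obtain ⟨B', hB'0, hB'⟩ : ∃ B' : ℝ, 0 ≤ B' ∧ volume (Metric.ball (0 : V3) 1) = ENNReal.ofReal B' :=
    ⟨_, ENNReal.toReal_nonneg, (ENNReal.ofReal_toReal measure_ball_lt_top.ne).symm⟩
  -- notation
  set μ₀ : Measure (Config N (Fin 3) T3 × (ℕ → V3)) :=
    (volume : Measure (Config N (Fin 3) T3)).prod (lambertNoise (Fin 3)) with hμ₀
  set S : ℕ → Set (Config N (Fin 3) T3) := fun n =>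
    {z : Config N (Fin 3) T3 | z ∈ D ∧ configEnergy z ≤ ((n : ℝ) + 1) ^ 2 / 2} with hS
  set cR : ℕ → ℝ := fun n =>
    A * Real.exp (-(β * ((n : ℝ) ^ 2 / 2))) * (1 + ((n : ℝ) + 1) ^ 2 / 2) with hcR
  set g : ℕ → ℝ := fun n =>
    A * (C' * b + B' ^ N) * (((n : ℝ) + 2) ^ (k + 3 * N + 2) * Real.exp (-(β / 2 * n))) with hg
  have hcR0 : ∀ n, 0 ≤ cR n := fun n => by positivity
  have hg0 : ∀ n, 0 ≤ g n := fun n => by positivity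
  have hgs : Summable g :=
    (collisionBudget_summable_pow_mul_exp (k + 3 * N + 2) (half_pos hβ)).mul_left (A * (C' * b + B' ^ N))
  have hGm : Measurable fun q : Config N (Fin 3) T3 × (ℕ → V3) => (K q : ℝ≥0∞) + 1 :=
    ((measurable_from_nat (f := fun n : ℕ => (n : ℝ≥0∞))).comp hK).add_const 1
  have hSm : ∀ n, MeasurableSet (S n ×ˢ (univ : Set (ℕ → V3))) := fun n =>
    (hD.inter (measurableSet_energyShell _)).prod MeasurableSet.univ
  have hDm : MeasurableSet (D ×ˢ (univ : Set (ℕ → V3))) := hD.prod MeasurableSet.univ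
  -- pointwise domination by the shell series
  have hpt : ∀ q ∈ D ×ˢ (univ : Set (ℕ → V3)),
      ENNReal.ofReal (ρ q.1) * ENNReal.ofReal (((K q : ℝ) + 1) * (1 + configEnergy q.1)) ≤
        ∑' n : ℕ, ENNReal.ofReal (cR n) * (S n ×ˢ (univ : Set (ℕ → V3))).indicator
          (fun q => (K q : ℝ≥0∞) + 1) q := by
    intro q hq
    have hE0 : 0 ≤ configEnergy q.1 := collisionBudget_configEnergy_nonneg q.1
    obtain ⟨n, hn1, hn2⟩ := collisionBudget_exists_shell hE0
    have hqS : q ∈ S n ×ˢ (univ : Set (ℕ → V3)) := ⟨⟨hq.1, hn2⟩, mem_univ _⟩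
    have hreal : ρ q.1 * (1 + configEnergy q.1) ≤ cR n :=
      mul_le_mul ((hρle q.1).trans (mul_le_mul_of_nonneg_left
        (Real.exp_le_exp.2 (neg_le_neg (mul_le_mul_of_nonneg_left hn1 hβ.le))) hA))
        (by linarith) (by linarith) (by positivity)
    calc ENNReal.ofReal (ρ q.1) * ENNReal.ofReal (((K q : ℝ) + 1) * (1 + configEnergy q.1))
        = ENNReal.ofReal (ρ q.1 * (1 + configEnergy q.1)) * ((K q : ℝ≥0∞) + 1) := by
          rw [ENNReal.ofReal_mul (by positivity : (0 : ℝ) ≤ (K q : ℝ) + 1),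
            ENNReal.ofReal_mul (hρ0 q.1), ENNReal.ofReal_add (Nat.cast_nonneg _) zero_le_one,
            ENNReal.ofReal_natCast, ENNReal.ofReal_one]
          ring
      _ ≤ ENNReal.ofReal (cR n) * ((K q : ℝ≥0∞) + 1) :=
          mul_le_mul_left (ENNReal.ofReal_le_ofReal hreal) _
      _ = ENNReal.ofReal (cR n) * (S n ×ˢ (univ : Set (ℕ → V3))).indicator
            (fun q => (K q : ℝ≥0∞) + 1) q := by rw [indicator_of_mem hqS]
      _ ≤ ∑' m : ℕ, ENNReal.ofReal (cR m) * (S m ×ˢ (univ : Set (ℕ → V3))).indicator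
            (fun q => (K q : ℝ≥0∞) + 1) q := ENNReal.le_tsum n
  -- the per-shell integrals
  have hterm : ∀ n : ℕ, ENNReal.ofReal (cR n) *
      ∫⁻ q in S n ×ˢ (univ : Set (ℕ → V3)), (K q : ℝ≥0∞) + 1 ∂μ₀ ≤ ENNReal.ofReal (g n) := by
    intro n
    have hV0 : (0 : ℝ) ≤ (n : ℝ) + 1 := by positivity
    have hKn : ∫⁻ q in S n ×ˢ (univ : Set (ℕ → V3)), (K q : ℝ≥0∞) ∂μ₀ ≤
        ENNReal.ofReal C' * ENNReal.ofReal ((1 + ((n : ℝ) + 1)) ^ k) * ENNReal.ofReal b := hCk _ hV0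
    have hvol : μ₀ (S n ×ˢ (univ : Set (ℕ → V3))) ≤ ENNReal.ofReal ((((n : ℝ) + 1) ^ 3 * B') ^ N) := by
      rw [hμ₀, Measure.prod_prod, measure_univ, mul_one]
      calc volume (S n) ≤ volume (velBall N (Fin 3) T3 ((n : ℝ) + 1)) :=
            measure_mono fun z hz => setOf_configEnergy_le_subset_velBall hV0 hz.2
        _ = volume (Metric.closedBall (0 : V3) ((n : ℝ) + 1)) ^ N := volume_velBall _
        _ = ENNReal.ofReal ((((n : ℝ) + 1) ^ 3 * B') ^ N) := by
            rw [Measure.addHaar_closedBall volume _ hV0, finrank_euclideanSpace_fin, hB',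
              ← ENNReal.ofReal_mul (by positivity), ← ENNReal.ofReal_pow (by positivity)]
    have hX : ∫⁻ q in S n ×ˢ (univ : Set (ℕ → V3)), (K q : ℝ≥0∞) + 1 ∂μ₀ ≤
        ENNReal.ofReal (C' * (1 + ((n : ℝ) + 1)) ^ k * b + (((n : ℝ) + 1) ^ 3 * B') ^ N) := by
      rw [lintegral_add_right _ measurable_const, lintegral_const, Measure.restrict_apply_univ, one_mul]
      calc ∫⁻ q in S n ×ˢ (univ : Set (ℕ → V3)), (K q : ℝ≥0∞) ∂μ₀ + μ₀ (S n ×ˢ (univ : Set (ℕ → V3)))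
          ≤ ENNReal.ofReal C' * ENNReal.ofReal ((1 + ((n : ℝ) + 1)) ^ k) * ENNReal.ofReal b +
              ENNReal.ofReal ((((n : ℝ) + 1) ^ 3 * B') ^ N) := add_le_add hKn hvol
        _ = ENNReal.ofReal (C' * (1 + ((n : ℝ) + 1)) ^ k * b + (((n : ℝ) + 1) ^ 3 * B') ^ N) := by
            rw [← ENNReal.ofReal_mul hC'0, ← ENNReal.ofReal_mul (by positivity),
              ← ENNReal.ofReal_add (by positivity) (by positivity)]
    calc ENNReal.ofReal (cR n) * ∫⁻ q in S n ×ˢ (univ : Set (ℕ → V3)), (K q : ℝ≥0∞) + 1 ∂μ₀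
        ≤ ENNReal.ofReal (cR n) *
            ENNReal.ofReal (C' * (1 + ((n : ℝ) + 1)) ^ k * b + (((n : ℝ) + 1) ^ 3 * B') ^ N) :=
          mul_le_mul_right hX _
      _ = ENNReal.ofReal (cR n * (C' * (1 + ((n : ℝ) + 1)) ^ k * b + (((n : ℝ) + 1) ^ 3 * B') ^ N)) :=
          (ENNReal.ofReal_mul (hcR0 n)).symm
      _ ≤ ENNReal.ofReal (g n) :=
          ENNReal.ofReal_le_ofReal (collisionBudget_term_le hA hβ hC'0 hb hB'0 k N n)
  -- integrate the series
  calc ∫⁻ q in D ×ˢ (univ : Set (ℕ → V3)),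
        ENNReal.ofReal (ρ q.1) * ENNReal.ofReal (((K q : ℝ) + 1) * (1 + configEnergy q.1)) ∂μ₀
      ≤ ∫⁻ q in D ×ˢ (univ : Set (ℕ → V3)), ∑' n : ℕ, ENNReal.ofReal (cR n) *
          (S n ×ˢ (univ : Set (ℕ → V3))).indicator (fun q => (K q : ℝ≥0∞) + 1) q ∂μ₀ :=
        setLIntegral_mono' hDm hpt
    _ ≤ ∫⁻ q, ∑' n : ℕ, ENNReal.ofReal (cR n) *
          (S n ×ˢ (univ : Set (ℕ → V3))).indicator (fun q => (K q : ℝ≥0∞) + 1) q ∂μ₀ :=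
        setLIntegral_le_lintegral _ _
    _ = ∑' n : ℕ, ENNReal.ofReal (cR n) * ∫⁻ q in S n ×ˢ (univ : Set (ℕ → V3)), (K q : ℝ≥0∞) + 1 ∂μ₀ := by
        rw [lintegral_tsum fun n => ((hGm.indicator (hSm n)).const_mul _).aemeasurable]
        exact tsum_congr fun n => by
          rw [lintegral_const_mul _ (hGm.indicator (hSm n)), lintegral_indicator (hSm n)]
    _ ≤ ∑' n : ℕ, ENNReal.ofReal (g n) := ENNReal.tsum_le_tsum hterm
    _ = ENNReal.ofReal (∑' n, g n) := (ENNReal.ofReal_tsum_of_nonneg hg0 hgs).symm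
    _ < ∞ := ENNReal.ofReal_lt_top

/-! ## The registered stub -/

/-- **`stub_collisionBudgetIntegrableLambda`** (line `Sketch` of the crux `LambertianContactSwap.LambertianEuler`; tool
of `WindowProductionBoundLambda`, `CollisionIntensityLambda → CollisionBudgetIntegrableLambda`). **The integrability
hypothesis of the collision compensator, discharged at fixed `N`**: granted the shell collision-intensity bound of the
Lambertian gas (`∫⁻_{(D ∩ {E ≤ V²/2}) × univ} K_t d(vol ⊗ γ^ℕ) ≤ C (1 + V)^k t`, the landed
`stub_collisionIntensityLambda`), under local Gibbs data `λ_N ⊗ γ^ℕ` (continuous positive profiles, `0 < σ < 1/2`)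
the budget `(K_b + 1)(1 + E)` is integrable for every `b ≥ 0` — exactly the hypothesis of
`stub_collisionCompensatorLambda` with `P := λ_N`. Route: `λ_N ⊗ γ^ℕ = ρ_λ · (vol|_D ⊗ γ^ℕ)`
(`localGibbsLaw_eq_withDensity_liouville`, `prod_withDensity_left`), Gaussian domination
`ρ_λ ≤ A e^{−βE}` (`collisionBudget_canonicalDensity_le`), the shell decomposition
`collisionBudget_lintegral_lt_top` at `ε = hsDiameter σ N`, `N + 1` spheres, and measurability of `K_b`
(`measurable_lambertCount`) and `E` (`measurable_configEnergy`). [folklore] -/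
theorem stub_collisionBudgetIntegrableLambda :
    (∀ {ε : ℝ}, 0 < ε → ε < 2⁻¹ → ∀ N : ℕ, ∃ C : ℝ≥0∞, C < ∞ ∧ ∃ k : ℕ, ∀ (V t : ℝ), 0 ≤ V → 0 ≤ t →
      ∫⁻ p in {z : Config N (Fin 3) T3 | z ∈ hardSphereDomain (Torus.geometry (Fin 3)) N ε ∧
          configEnergy z ≤ V ^ 2 / 2} ×ˢ (Set.univ : Set (ℕ → V3)),
        (lambertCount (Torus.geometry (Fin 3)) ε p.2 p.1 t : ℝ≥0∞)
          ∂((volume : Measure (Config N (Fin 3) T3)).prod (lambertNoise (Fin 3))) ≤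
      C * ENNReal.ofReal ((1 + V) ^ k) * ENNReal.ofReal t) →
    ∀ {σ : ℝ}, 0 < σ → σ < 2⁻¹ → ∀ {a₀ θ₀ : T3 → ℝ} {u₀ : T3 → V3},
      Continuous a₀ → Continuous θ₀ → Continuous u₀ → (∀ x, 0 < a₀ x) → (∀ x, 0 < θ₀ x) →
      ∀ (N : ℕ) (Φ : HardSphereFlow (Torus.geometry (Fin 3)) (hsDiameter σ N) (N + 1)) (b : ℝ), 0 ≤ b →
        Integrable (fun q : Config (N + 1) (Fin 3) T3 × (ℕ → V3) =>
            ((lambertCount (Torus.geometry (Fin 3)) (hsDiameter σ N) q.2 q.1 b : ℝ) + 1) *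
              (1 + configEnergy q.1))
          ((localGibbsLaw σ a₀ u₀ θ₀ N Φ).prod (lambertNoise (Fin 3))) := by
  intro hInt σ hσ hσ' a₀ θ₀ u₀ ha hθ hu ha0 hθ0 N Φ b hb
  have hσ2 : σ ≤ 1 / 2 := by rw [one_div]; exact hσ'.le
  have hε : 0 < hsDiameter σ N := hsDiameter_pos hσ N
  have hε' : hsDiameter σ N < 2⁻¹ := (hsDiameter_le hσ.le N).trans_lt hσ'
  obtain ⟨C, hC, k, hCk⟩ := hInt hε hε' (N + 1)
  obtain ⟨A, β, hA, hβ, hρle⟩ := collisionBudget_canonicalDensity_le hσ2 ha hθ hu ha0 hθ0 N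
  have hρ0 : ∀ z : Config (N + 1) (Fin 3) T3, 0 ≤ canonicalDensity (Torus.geometry (Fin 3)) (hsDiameter σ N) (N + 1)
      (localGibbsProfile a₀ u₀ θ₀) z := fun z =>
    canonicalDensity_localGibbsProfile_nonneg (fun x => (ha0 x).le) (fun x => (hθ0 x).le) _ _ z
  have hρm : Measurable fun z : Config (N + 1) (Fin 3) T3 => ENNReal.ofReal
      (canonicalDensity (Torus.geometry (Fin 3)) (hsDiameter σ N) (N + 1) (localGibbsProfile a₀ u₀ θ₀) z) :=
    (measurable_canonicalDensity (hsDiameter σ N) (N + 1) (measurable_localGibbsProfile ha hθ hu)).ennreal_ofReal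
  have hρm1 : Measurable fun q : Config (N + 1) (Fin 3) T3 × (ℕ → V3) => ENNReal.ofReal
      (canonicalDensity (Torus.geometry (Fin 3)) (hsDiameter σ N) (N + 1) (localGibbsProfile a₀ u₀ θ₀) q.1) :=
    hρm.comp measurable_fst
  have hKm : Measurable fun p : Config (N + 1) (Fin 3) T3 × (ℕ → V3) =>
      lambertCount (Torus.geometry (Fin 3)) (hsDiameter σ N) p.2 p.1 b :=
    measurable_lambertCount (Torus.isHardSphereRegular_geometry (d := Fin 3) hε') Torus.isMeasurable_geometry b
  have hfm : Measurable fun q : Config (N + 1) (Fin 3) T3 × (ℕ → V3) =>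
      ((lambertCount (Torus.geometry (Fin 3)) (hsDiameter σ N) q.2 q.1 b : ℝ) + 1) * (1 + configEnergy q.1) :=
    (((measurable_from_nat (f := fun n : ℕ => (n : ℝ))).comp hKm).add_const 1).mul
      ((measurable_configEnergy.comp measurable_fst).const_add 1)
  have hf0 : ∀ q : Config (N + 1) (Fin 3) T3 × (ℕ → V3),
      0 ≤ ((lambertCount (Torus.geometry (Fin 3)) (hsDiameter σ N) q.2 q.1 b : ℝ) + 1) * (1 + configEnergy q.1) :=
    fun q => mul_nonneg (by positivity) (add_nonneg zero_le_one (collisionBudget_configEnergy_nonneg q.1))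
  haveI hXE : SigmaFinite (volume : Measure (T3 × V3)) := inferInstance
  haveI hCv : SigmaFinite (volume : Measure (Config (N + 1) (Fin 3) T3)) := inferInstance
  have hP : (localGibbsLaw σ a₀ u₀ θ₀ N Φ).prod (lambertNoise (Fin 3)) =
      (((volume : Measure (Config (N + 1) (Fin 3) T3)).prod (lambertNoise (Fin 3))).restrict
        (hardSphereDomain (Torus.geometry (Fin 3)) (N + 1) (hsDiameter σ N) ×ˢ (univ : Set (ℕ → V3)))).withDensity
        fun q => ENNReal.ofReal (canonicalDensity (Torus.geometry (Fin 3)) (hsDiameter σ N) (N + 1)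
          (localGibbsProfile a₀ u₀ θ₀) q.1) := by
    rw [localGibbsLaw_eq_withDensity_liouville, liouville_eq, prod_withDensity_left hρm,
      Measure.restrict_prod_eq_prod_univ]
  refine ⟨hfm.aestronglyMeasurable, ?_⟩
  rw [hasFiniteIntegral_iff_ofReal (ae_of_all _ hf0), hP,
    lintegral_withDensity_eq_lintegral_mul _ hρm1 hfm.ennreal_ofReal]
  exact collisionBudget_lintegral_lt_top
    (measurableSet_hardSphereDomain _ Torus.measurable_geometry_sepVec (N + 1) (hsDiameter σ N)) hKm hC hb
    (fun V hV => hCk V b hV hb) hρ0 hA hβ hρle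

end Summit.AtomisticToContinuum.HydrodynamicLimit.Theorems.LambertianContactSwapLambertianEulerCollisionBudget

end
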